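import Summits.QuantumAdvantage.AdviceFreeQNC0.FibreDecimation37
import HarnessLib

/-!
# Cell qa-qnc0, `p = 3` — ROUND-37P2 File B, STEP 1 toolkit: splitting the coin cube along the `m` chosen coins
# `ι : Fin m ↪ Fin z` (`u ↔ (w, y)`, `w` on `M = range ι`, `y` on `Y = [z] ∖ M`)

Planner qa-qnc0-p2 g37, ROUND-37P2 §2 STEP 1 ("write `u = (w,y)`"): the bookkeeping that lets the typed statement
`FibreNonExact37NH` (arbitrary embedding `ι`) be read fibre by fibre.  `Out ι` is the type of outside coins,
`glue ι w y` the point of `{0,1}^z` with `M`-part `w` and `Y`-part `y`; `glue_apply_emb` / `glue_apply_out` / `out_glue`;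
`sum_split` (`Σ_c g c = Σ_i g(ι i) + Σ_{c ∈ Y} g c`), `card_filter_split` (weights add), `card_out` (`|Y| = z − m`),
`card_filter_subtype` (a filter over `Out ι` is a filter over `Fin z` with the extra clause `c ∉ range ι`).

WHAT THIS IS NOT: no statement about the game; pure finite bookkeeping for the sequel (`FibreDecimation37NH*.lean`).
-/

noncomputable section

namespace Summit.QuantumAdvantage.AdviceFreeQNC0.Exp37

open Finset

variable {z m : ℕ}

/-- The outside coins `Y = [z] ∖ range ι`. -/
abbrev Out (ι : Fin m ↪ Fin z) : Type := {c : Fin z // c ∉ Set.range ι}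

/-- Glue an `M`-part `w` and a `Y`-part `y` to a point of the coin cube. -/
def glue (ι : Fin m ↪ Fin z) (w : Fin m → Bool) (y : Out ι → Bool) : Fin z → Bool :=
  fun c => if h : c ∈ Set.range ι then w ((Equiv.ofInjective ι ι.injective).symm ⟨c, h⟩) else y ⟨c, h⟩

/-- On a chosen coin the glued point reads `w`. -/
theorem glue_apply_emb (ι : Fin m ↪ Fin z) (w : Fin m → Bool) (y : Out ι → Bool) (i : Fin m) :
    glue ι w y (ι i) = w i := by
  unfold glue
  rw [dif_pos ⟨i, rfl⟩]
  congr 1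
  exact Equiv.ofInjective_symm_apply ι.injective i

/-- On an outside coin the glued point reads `y`. -/
theorem glue_apply_out (ι : Fin m ↪ Fin z) (w : Fin m → Bool) (y : Out ι → Bool) (c : Out ι) :
    glue ι w y c.1 = y c := by
  unfold glue
  rw [dif_neg c.2]

/-- The `Y`-part of a glued point. -/
theorem out_glue (ι : Fin m ↪ Fin z) (w : Fin m → Bool) (y : Out ι → Bool) :
    (fun c : Out ι => glue ι w y c.1) = y := funext fun c => glue_apply_out ι w y c

/-- **Splitting a sum over the coins**: `Σ_c g(c) = Σ_i g(ι i) + Σ_{c : Y} g(c)`. -/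
theorem sum_split {M : Type*} [AddCommMonoid M] (ι : Fin m ↪ Fin z) (g : Fin z → M) :
    ∑ c, g c = ∑ i : Fin m, g (ι i) + ∑ c : Out ι, g c.1 := by
  rw [← Fintype.sum_subtype_add_sum_subtype (fun c : Fin z => c ∈ Set.range ι) g]
  congr 1
  symm
  convert Fintype.sum_equiv (Equiv.ofInjective ι ι.injective) (fun i => g (ι i)) (fun c => g c.1) fun i => rfl
    using 3

/-- Splitting a sum over the coins at a glued point. -/
theorem sum_split_glue {M : Type*} [AddCommMonoid M] (ι : Fin m ↪ Fin z) (w : Fin m → Bool) (y : Out ι → Bool)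
    (g : Fin z → Bool → M) :
    ∑ c, g c (glue ι w y c) = ∑ i : Fin m, g (ι i) (w i) + ∑ c : Out ι, g c.1 (y c) := by
  rw [sum_split ι]
  simp only [glue_apply_emb, glue_apply_out]

/-- **Weights add**: `#{c : u_c ∧ P c} = #{i : w_i ∧ P(ι i)} + #{c ∈ Y : y_c ∧ P c}` for `u = glue w y`. -/
theorem card_filter_glue (ι : Fin m ↪ Fin z) (w : Fin m → Bool) (y : Out ι → Bool) (P : Fin z → Prop)
    [DecidablePred P] :
    (univ.filter fun c => glue ι w y c = true ∧ P c).card =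
      (univ.filter fun i : Fin m => w i = true ∧ P (ι i)).card +
        (univ.filter fun c : Out ι => y c = true ∧ P c.1).card := by
  classical
  rw [card_filter, card_filter, card_filter]
  rw [sum_split_glue ι w y (fun c b => if b = true ∧ P c then 1 else 0)]

/-- The weight of a glued point: `|u| = |w| + |y|`. -/
theorem card_true_glue (ι : Fin m ↪ Fin z) (w : Fin m → Bool) (y : Out ι → Bool) :
    (univ.filter fun c => glue ι w y c = true).card =
      (univ.filter fun i : Fin m => w i = true).card + (univ.filter fun c : Out ι => y c = true).card := by
  have h := card_filter_glue ι w y (fun _ => True)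
  simp only [and_true] at h
  exact h

/-- **`|Y| = z − m`.** -/
theorem card_out (ι : Fin m ↪ Fin z) : Fintype.card (Out ι) = z - m := by
  classical
  rw [Fintype.card_subtype_compl, Fintype.card_fin]
  have h : Fintype.card {c : Fin z // c ∈ Set.range ι} = m := by
    rw [show Fintype.card {c : Fin z // c ∈ Set.range ι} = Fintype.card (Set.range ι) from rfl,
      Set.card_range_of_injective ι.injective, Fintype.card_fin]
  rw [h]

/-- A filter over the outside coins is a filter over all coins with the clause `c ∉ range ι`. -/
theorem card_filter_subtype (ι : Fin m ↪ Fin z) (Q : Fin z → Prop) [DecidablePred Q] :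
    (univ.filter fun c : Out ι => Q c.1).card = (univ.filter fun c : Fin z => c ∉ Set.range ι ∧ Q c).card := by
  classical
  rw [← Fintype.card_subtype, ← Fintype.card_subtype]
  exact Fintype.card_congr (Equiv.subtypeSubtypeEquivSubtypeInter (fun c : Fin z => c ∉ Set.range ι) Q)

/-- Gluing is injective in the `Y`-part (for any choice of `M`-parts). -/
theorem glue_injective_out (ι : Fin m ↪ Fin z) (wf : (Out ι → Bool) → (Fin m → Bool)) :
    Function.Injective fun y : Out ι → Bool => glue ι (wf y) y := by
  intro y y' h
  have h1 := out_glue ι (wf y) y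
  have h2 := out_glue ι (wf y') y'
  rw [← h1, ← h2]
  funext c
  exact congrFun (congrArg (fun u : Fin z → Bool => fun c : Out ι => u c.1) h) c

end Summit.QuantumAdvantage.AdviceFreeQNC0.Exp37

end
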